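import Literature.Computability.FineGrained.SerfRedParser
import HarnessLib

/-!
# Sparsification as a word-RAM SERF reduction: presenting a leaf to the sparse-`k`-SAT program

Infrastructure for the discharge of
`Literature.Computability.FineGrained.kSATInRAMTime_of_sparseKSATInRAMTime_serf` (`OVFromSETH.lean`;
Impagliazzo–Paturi–Zane, JCSS 63 (2001), Thm. 1, Cor. 1–2), continuing `SerfRedParser.lean`. The
driver of the SERF reduction runs, once per leaf `ψ` of the sparsifier's output, the hypothetical
sparse-`k`-SAT program `M` inside the emulator of `…Cryptography.WordRAMEmulator`; this file is the
structured word-RAM code between the parser and the emulated run, and after it, with its semantics: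

* `pres k n cs` — the formula actually presented: the empty formula if the leaf has an empty clause
  (its answer is then discarded), the leaf padded with the tautological clause `x_{n-1} ∨ ¬x_{n-1}`
  if `k ≥ 2` and the last variable is absent (so that `numVars = n` and the leaf's density bound
  applies), the leaf itself otherwise;
* `leafInit`, `leafTail` (`thenNormal`/`padBlock`/`elseEmpty`, `header`, `widthP`, `wsP`,
  `stampPass`), `leafBody = leafInit; formulaP; leafTail`, `post`, `fin`, with the certificates
  `leafBody_exec` (the body leaves `|y| :: y`, `y = encodeCNFWords (pres k n ψ.clauses)`, reduced
  modulo `2^ws` and stamped with the bumped generation, `ws = k' (numVars + inputWidth y)`),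
  `present_agree` / `present_stampLE` (that memory *is* the emulator's view of `init ws y`),
  `post_exec` (read the answer bit, or it into the accumulator, recompute the loop flag),
  `fin_exec` (output the accumulator);
* `CLE` / `Exec.memLE` — query-free structured code with constants `≤ V` preserves the value bound
  `V ≥ 2^W - 1` required by the emulator's target invariant.

[folklore] engineering (Nipkow–Klein, *Concrete Semantics*, §12: `WHILE` programs by invariants);
the padding step is the one described in the docstring of the named fact (IPZ Cor. 2 read on the
word RAM).
-/

namespace Literature.Computability.FineGrained.SerfRed

open _root_.Computability Cryptography Cryptography.WordRAM Cryptography.WordRAM.SProg Complexity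
  KSatTranscoder

/-! ### A value bound along structured code -/

/-- `CLE V s`: every constant (immediate or address literal) of the structured code `s` is at most
`V` (tests write nothing and are not counted). [folklore] -/
def CLE (V : ℕ) : SProg → Prop
  | .op _ d x y => d.const ≤ V ∧ x.const ≤ V ∧ y.const ≤ V
  | .query _ _ _ => True
  | .skip => True
  | .seq s t => CLE V s ∧ CLE V t
  | .ifz _ s t => CLE V s ∧ CLE V t
  | .whilenz _ s => CLE V s

/-- `CLE` of a block. [folklore] -/
@[simp] theorem cle_block_cons (V : ℕ) (s : OpSpec) (ops : List OpSpec) :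
    CLE V (block (s :: ops)) ↔ (s.2.1.const ≤ V ∧ s.2.2.1.const ≤ V ∧ s.2.2.2.const ≤ V) ∧ CLE V (block ops) :=
  Iff.rfl

/-- `CLE` of the empty block. [folklore] -/
@[simp] theorem cle_block_nil (V : ℕ) : CLE V (block []) ↔ True := Iff.rfl

/-- `CLE` of a sequence. [folklore] -/
@[simp] theorem cle_seqs_cons (V : ℕ) (s : SProg) (l : List SProg) :
    CLE V (seqs (s :: l)) ↔ CLE V s ∧ CLE V (seqs l) := Iff.rfl

/-- `CLE` of the empty sequence. [folklore] -/
@[simp] theorem cle_seqs_nil (V : ℕ) : CLE V (seqs []) ↔ True := Iff.rfl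

/-- **Query-free structured code preserves a value bound** `V ≥ 2 ^ W - 1`, `V ≥ 1` covering its
constants (from `execOp_memLE`). [folklore] -/
theorem Exec.memLE {W : ℕ} {O : List ℕ → List ℕ} {V : ℕ} (hW : 2 ^ W - 1 ≤ V) (h1 : 1 ≤ V)
    {s : SProg} {st st' : Store} {t : ℕ} (h : Exec W O s st st' t) :
    s.QueryFree → CLE V s → MemLE V st.mem → MemLE V st'.mem := by
  induction h with
  | op o dst x y st =>
    exact fun _ hc hm => execOp_memLE hW h1 hm (o, dst, x, y)
      (by simp only [OpSpec.maxConst, OpSpec.toInstr, Instr.maxConst, max_le_iff]; exact ⟨hc.1, hc.2.1, hc.2.2⟩)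
  | query qa ql aa st => exact fun hq => hq.elim
  | skip st => exact fun _ _ hm => hm
  | seq _ _ ih₁ ih₂ => exact fun hq hc hm => ih₂ hq.2 hc.2 (ih₁ hq.1 hc.1 hm)
  | ifz_zero _ _ ih => exact fun hq hc hm => ih hq.1 hc.1 hm
  | ifz_ne _ _ ih => exact fun hq hc hm => ih hq.2 hc.2 hm
  | while_zero _ => exact fun _ _ hm => hm
  | while_ne _ _ _ ih ih' => exact fun hq hc hm => ih' hq hc (ih hq hc hm)

/-! ### The presented formula -/

-- The tautological padding clause `x_{n-1} ∨ ¬ x_{n-1}` is `SparseSatBridge.padClause`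
-- (`CliqueETHMachineModel.lean`), reused here.
open SparseSatBridge (padClause)

/-- **The formula presented to the sparse-`k`-SAT program** for a leaf with clause list `cs` of a
`k`-CNF on `n` variables: the empty formula if `cs` has an empty clause (the leaf is
unsatisfiable and the answer is discarded); `cs` padded with the tautological clause on the last
variable if `k ≥ 2` and the last variable does not occur in `cs` (so that `numVars = n` and the
density bound of the leaf applies); `cs` itself otherwise.
[cite: ImpagliazzoPaturiZaneJCSS2001, Cor. 2 (the SERF reduction)] -/
def pres (k n : ℕ) (cs : CNF ℕ) : CNF ℕ :=
  if [] ∈ cs then [] else if 2 ≤ k ∧ CNF.numVars cs < n then cs ++ [padClause n] else cs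

/-! ### The tail of the leaf body: padding, header, word size, stamps -/

/-! Register map (continued): `24 = N0` (`n`), `30 … 36` the emulator layout (`30 = Bv`, `31 = Sv`,
`32 = G`, `33 = 2^ws`, temporaries `34, 35, 36`), `52 = LY` (`|y|`), `53 = NFIN`, `54 = WY`,
`55 = WS`, `56` halving scratch, `57 = A`, `58 = S` (cell / stamp pointers of the pass), `25 = ACC`,
`26 = B` (answer bit), `21 = BOT`, `22 = FLAG`. -/

/-- The emulator layout of the driver. [folklore] -/
def lay : Layout := ⟨30, 31, 32, 33, 34, 35, 36⟩

/-- The padding block (`k ≥ 2`, last variable absent): append the words `2, 2n-1, 2n-2` of the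
padding clause, count it, `NFIN := n`, and fold `2n-1`, `2` into `WMAX`. [folklore] -/
def padBlock : SProg :=
  seqs [block [(.band, pt 40, im 2, im 2), (.add, r 40, r 40, im 1), (.add, r 50, r 24, r 24),
      (.sub, r 50, r 50, im 1)],
    block [(.div, pt 40, r 50, im 1), (.add, r 40, r 40, im 1), (.sub, r 51, r 50, im 1)],
    block [(.div, pt 40, r 51, im 1), (.add, r 40, r 40, im 1), (.add, r 41, r 41, im 1), (.div, r 53, r 24, im 1),
      (.band, r 51, im 2, im 2)],
    maxInto 44 50 59, maxInto 44 51 59]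

/-- The normal branch (no empty clause): `NFIN := NMAX`, pad if `k ≥ 2` and `NMAX < n`,
`LY := OUT - Bv - 1`. [folklore] -/
def thenNormal (k : ℕ) : SProg :=
  seqs [block [(.div, r 53, r 42, im 1), (.lt, r 50, r 42, r 24)],
    (if 2 ≤ k then ifz (r 50) skip padBlock else skip),
    block [(.sub, r 52, r 40, r 30), (.sub, r 52, r 52, im 1)]]

/-- The empty-clause branch: present the empty formula `[0, 0]`. [folklore] -/
def elseEmpty : SProg :=
  block [(.band, r 52, im 2, im 2), (.band, r 53, im 0, im 0), (.band, r 41, im 0, im 0), (.band, r 44, im 0, im 0)]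

/-- The header: cells `Bv + 1 := NFIN`, `Bv + 2 := M`, `Bv := LY`, and
`WMAX := max (WMAX, NFIN, M, LY, 1)`. [folklore] -/
def header : SProg :=
  seqs [block [(.add, r 50, r 30, im 1), (.div, pt 50, r 53, im 1), (.add, r 50, r 30, im 2),
      (.div, pt 50, r 41, im 1), (.div, pt 30, r 52, im 1), (.band, r 51, im 1, im 1)],
    maxInto 44 53 59, maxInto 44 41 59, maxInto 44 52 59, maxInto 44 51 59]

/-- `WY := Nat.size WMAX` by halving. [folklore] -/
def widthP : SProg :=
  seqs [block [(.div, r 56, r 44, im 1), (.band, r 54, im 0, im 0)],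
    whilenz (r 56) (block [(.shr, r 56, r 56, im 1), (.add, r 54, r 54, im 1)])]

/-- `WS := k' (NFIN + WY)`, `rP := 2 ^ WS`. [folklore] -/
def wsP (k' : ℕ) : SProg :=
  block [(.add, r 55, r 53, r 54), (.mul, r 55, r 55, im k'), (.shl, r 33, im 1, r 55)]

/-- The reduce-and-stamp pass over the `LY + 1` presented cells: `cell %= 2^ws; stamp := G`.
[folklore] -/
def stampPass : SProg :=
  seqs [block [(.div, r 57, r 30, im 1), (.div, r 58, r 31, im 1), (.add, r 50, r 52, im 1)],
    whilenz (r 50) (block [(.mod, pt 57, pt 57, r 33), (.div, pt 58, r 32, im 1), (.add, r 57, r 57, im 1),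
      (.add, r 58, r 58, im 1), (.sub, r 50, r 50, im 1)])]

/-- **The tail of the leaf body**, after the parser. [folklore] -/
def leafTail (k k' : ℕ) : SProg :=
  seqs [ifz (r 43) (thenNormal k) elseEmpty, header, widthP, wsP k', stampPass]

/-- The start of the leaf body: bump the generation, reset the parser's output pointer
(`OUT := Bv + 3`) and counters. [folklore] -/
def leafInit : SProg :=
  block [(.add, r 32, r 32, im 1), (.add, r 40, r 30, im 3), (.band, r 41, im 0, im 0), (.band, r 42, im 0, im 0),
    (.band, r 43, im 0, im 0), (.band, r 44, im 0, im 0)]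

/-- **The leaf body**: generation, parser, tail. [folklore] -/
def leafBody (C : PCodes) (κ k k' : ℕ) : SProg :=
  seqs [leafInit, formulaP C κ, leafTail k k']

/-- **After the emulated run**: read the answer bit (emulated cell `1`), or it into `ACC` unless the
leaf had an empty clause, recompute the loop flag `FLAG := (BOT < P)`. [folklore] -/
def post : SProg :=
  seqs [block (erdAt lay (im 1) 26),
    ifz (r 43) (block [(.add, r 25, r 25, r 26), (.lt, r 25, im 0, r 25)]) skip,
    block [(.lt, r 22, r 21, r 20)]]

/-- **The exit**: output `[ACC]`. [folklore] -/
def fin : SProg := block [(.div, r 1, r 25, im 1), (.band, r 0, im 1, im 1)]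

/-- The tail, body, post and exit are query-free. [folklore] -/
theorem leafBody_queryFree (C : PCodes) (κ k k' : ℕ) : (leafBody C κ k k').QueryFree := by
  refine ⟨block_queryFree _, formulaP_queryFree C κ, ?_, trivial⟩
  unfold leafTail thenNormal
  split_ifs <;>
    simp [seqs, QueryFree, block_queryFree, elseEmpty, header, widthP, wsP, stampPass, padBlock, maxInto]

/-- `post` is query-free. [folklore] -/
theorem post_queryFree : post.QueryFree := by
  simp [post, seqs, QueryFree, block_queryFree]

/-- `fin` is query-free. [folklore] -/
theorem fin_queryFree : fin.QueryFree := block_queryFree _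

/-! ### Semantics of the tail -/

section exec

variable {w : ℕ} {O : List ℕ → List ℕ} {C : PCodes} {κ : ℕ}

/-- Writing below an output region commutes with it. [folklore] -/
theorem outMem_update_below (G : ℕ → ℕ) {e₀ a : ℕ} (ys : List ℕ) (ha : a < e₀) (v : ℕ) :
    Function.update (outMem G e₀ ys) a v = outMem (Function.update G a v) e₀ ys := by
  funext b
  by_cases hb : b = a
  · subst hb; rw [Function.update_self, outMem_of_lt _ _ ha, Function.update_self]
  · rw [Function.update_of_ne hb]
    unfold outMem
    rw [Function.update_of_ne hb]

/-- The three header cells below the clause words make one output region from `Bv`. [folklore] -/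
theorem outMem_header (G : ℕ → ℕ) (Bv : ℕ) (ws : List ℕ) (a b c : ℕ) :
    outMem (Function.update (Function.update (Function.update G (Bv + 1) a) (Bv + 2) b) Bv c) (Bv + 3) ws =
      outMem G Bv (c :: a :: b :: ws) := by
  funext x
  unfold outMem
  simp only [List.length_cons]
  by_cases h1 : Bv + 3 ≤ x ∧ x < Bv + 3 + ws.length
  · rw [if_pos h1, if_pos ⟨by omega, by omega⟩]
    obtain ⟨d, rfl⟩ : ∃ d, x = Bv + 3 + d := ⟨x - (Bv + 3), by omega⟩
    rw [show Bv + 3 + d - (Bv + 3) = d by omega, show Bv + 3 + d - Bv = d + 3 by omega]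
    rfl
  · rw [if_neg h1]
    by_cases h2 : Bv ≤ x ∧ x < Bv + (ws.length + 1 + 1 + 1)
    · rw [if_pos h2]
      have hx : x = Bv ∨ x = Bv + 1 ∨ x = Bv + 2 := by omega
      rcases hx with rfl | rfl | rfl
      · rw [Function.update_self, Nat.sub_self]; rfl
      · rw [Function.update_of_ne (by omega), Function.update_of_ne (by omega), Function.update_self,
          Nat.add_sub_cancel_left]; rfl
      · rw [Function.update_of_ne (by omega), Function.update_self, Nat.add_sub_cancel_left]; rfl
    · rw [if_neg h2, Function.update_of_ne (by omega), Function.update_of_ne (by omega),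
        Function.update_of_ne (by omega)]

/-- The words of the padding clause. [folklore] -/
theorem clauseWords_padClause (n : ℕ) (hn : 1 ≤ n) :
    KSatTranscoder.clauseWords [padClause n] = [2, 2 * n - 1, 2 * n - 2] := by
  simp [KSatTranscoder.clauseWords, padClause, litWord]; omega

/-- **The padding block.** [folklore] -/
theorem padBlock_exec {G R : ℕ → ℕ} {e₀ n : ℕ} {wl : List ℕ} (he : 100 ≤ e₀) (hn : 1 ≤ n)
    (h24 : R 24 = n) (h40 : R 40 = e₀ + wl.length) (hw : e₀ + wl.length + 3 < 2 ^ w) (hnw : n + n < 2 ^ w)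
    (h41 : R 41 + 1 < 2 ^ w) (qs : List (List ℕ)) :
    ∃ (R' : ℕ → ℕ) (t : ℕ), Exec w O padBlock ⟨merge R (outMem G e₀ wl), qs⟩
        ⟨merge R' (outMem G e₀ (wl ++ [2, 2 * n - 1, 2 * n - 2])), qs⟩ t ∧
      t ≤ 20 ∧ R' 40 = e₀ + wl.length + 3 ∧ R' 41 = R 41 + 1 ∧ R' 53 = n ∧
      R' 44 = max (R 44) (max (2 * n - 1) 2) ∧
      ∀ a, a ∉ [40, 41, 44, 50, 51, 53, 59] → R' a = R a := by
  have hew : e₀ + wl.length + 3 < 2 ^ w := hw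
  -- 1.
  set R₁ : ℕ → ℕ := Function.update (Function.update R 40 (e₀ + wl.length + 1)) 50 (2 * n - 1) with hR₁
  have hA1 : BinOp.eval w .add (e₀ + wl.length) 1 = e₀ + wl.length + 1 := BinOp.eval_add_of_lt (by omega)
  have hA2 : BinOp.eval w .add n n = n + n := BinOp.eval_add_of_lt hnw
  have hS1 : BinOp.eval w .sub (n + n) 1 = 2 * n - 1 := by
    rw [BinOp.eval_sub_of_le (by omega) hnw]; omega
  have h1 : Exec w O (block [(.band, pt 40, im 2, im 2), (.add, r 40, r 40, im 1), (.add, r 50, r 24, r 24),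
      (.sub, r 50, r 50, im 1)]) ⟨merge R (outMem G e₀ wl), qs⟩ ⟨merge R₁ (outMem G e₀ (wl ++ [2])), qs⟩ 4 := by
    refine Exec.block' _ qs ?_
    simp (disch := first | decide | omega) only [execOps_cons, execOps_nil, execOp, Operand.read,
      Operand.write, merge_apply_of_lt, update_merge_of_lt, update_merge_of_le, Function.update_self,
      Function.update_of_ne, h40, h24, BinOp.eval_band, Nat.and_self, hA1, hA2, hS1, outMem_snoc, hR₁,
      Function.update_idem]
  -- 2.
  set R₂ : ℕ → ℕ := Function.update (Function.update R₁ 40 (e₀ + wl.length + 2)) 51 (2 * n - 2) with hR₂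
  have h40₁ : R₁ 40 = e₀ + (wl ++ [2]).length := by simp [hR₁, Nat.add_assoc]
  have h50₁ : R₁ 50 = 2 * n - 1 := by simp [hR₁]
  have hA3 : BinOp.eval w .add (e₀ + (wl ++ [2]).length) 1 = e₀ + wl.length + 2 := by
    rw [BinOp.eval_add_of_lt (by simp; omega)]; simp; omega
  have hS2 : BinOp.eval w .sub (2 * n - 1) 1 = 2 * n - 2 := by
    rw [BinOp.eval_sub_of_le (by omega) (by omega)]; omega
  have h2 : Exec w O (block [(.div, pt 40, r 50, im 1), (.add, r 40, r 40, im 1), (.sub, r 51, r 50, im 1)])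
      ⟨merge R₁ (outMem G e₀ (wl ++ [2])), qs⟩ ⟨merge R₂ (outMem G e₀ (wl ++ [2] ++ [2 * n - 1])), qs⟩ 3 := by
    refine Exec.block' _ qs ?_
    have hl : 100 ≤ e₀ + (wl ++ [2]).length := by simp; omega
    simp (disch := first | decide | omega) only [execOps_cons, execOps_nil, execOp, Operand.read,
      Operand.write, merge_apply_of_lt, update_merge_of_lt, update_merge_of_le,
      Function.update_of_ne, h40₁, h50₁, BinOp.eval_div_one, hA3, hS2, outMem_snoc, hR₂]
  -- 3.
  set R₃ : ℕ → ℕ := Function.update (Function.update (Function.update (Function.update R₂ 40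
    (e₀ + wl.length + 3)) 41 (R 41 + 1)) 53 n) 51 2 with hR₃
  have h40₂ : R₂ 40 = e₀ + (wl ++ [2] ++ [2 * n - 1]).length := by simp [hR₂, Nat.add_assoc]
  have h51₂ : R₂ 51 = 2 * n - 2 := by simp [hR₂]
  have h41₂ : R₂ 41 = R 41 := by simp [hR₂, hR₁]
  have h24₂ : R₂ 24 = n := by simp [hR₂, hR₁, h24]
  have hA4 : BinOp.eval w .add (e₀ + (wl ++ [2] ++ [2 * n - 1]).length) 1 = e₀ + wl.length + 3 := by
    rw [BinOp.eval_add_of_lt (by simp; omega)]; simp; omega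
  have hA5 : BinOp.eval w .add (R 41) 1 = R 41 + 1 := BinOp.eval_add_of_lt h41
  have h3 : Exec w O (block [(.div, pt 40, r 51, im 1), (.add, r 40, r 40, im 1), (.add, r 41, r 41, im 1),
      (.div, r 53, r 24, im 1), (.band, r 51, im 2, im 2)])
      ⟨merge R₂ (outMem G e₀ (wl ++ [2] ++ [2 * n - 1])), qs⟩
      ⟨merge R₃ (outMem G e₀ (wl ++ [2] ++ [2 * n - 1] ++ [2 * n - 2])), qs⟩ 5 := by
    refine Exec.block' _ qs ?_
    have hl : 100 ≤ e₀ + (wl ++ [2] ++ [2 * n - 1]).length := by simp; omega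
    simp (disch := first | decide | omega) only [execOps_cons, execOps_nil, execOp, Operand.read,
      Operand.write, merge_apply_of_lt, update_merge_of_lt, update_merge_of_le,
      Function.update_of_ne, h40₂, h51₂, h41₂, h24₂, BinOp.eval_div_one, hA4, hA5, BinOp.eval_band,
      Nat.and_self, outMem_snoc, hR₃]
  -- 4./5.
  obtain ⟨t₄, ht₄, h4⟩ := maxInto_exec (w := w) (O := O) (R := R₃)
    (H := outMem G e₀ (wl ++ [2] ++ [2 * n - 1] ++ [2 * n - 2])) (dst := 44) (src := 50) (s := 59)
    (by decide) (by decide) (by decide) (by decide) (by decide) qs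
  set R₄ : ℕ → ℕ := Function.update (Function.update R₃ 59 (if R₃ 44 < R₃ 50 then 1 else 0)) 44
    (max (R₃ 44) (R₃ 50)) with hR₄
  obtain ⟨t₅, ht₅, h5⟩ := maxInto_exec (w := w) (O := O) (R := R₄)
    (H := outMem G e₀ (wl ++ [2] ++ [2 * n - 1] ++ [2 * n - 2])) (dst := 44) (src := 51) (s := 59)
    (by decide) (by decide) (by decide) (by decide) (by decide) qs
  have e : wl ++ [2] ++ [2 * n - 1] ++ [2 * n - 2] = wl ++ [2, 2 * n - 1, 2 * n - 2] := by simp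
  rw [e] at h4 h5 h3
  have h44₃ : R₃ 44 = R 44 := by simp [hR₃, hR₂, hR₁]
  have h50₃ : R₃ 50 = 2 * n - 1 := by simp [hR₃, hR₂, hR₁]
  refine ⟨_, 4 + (3 + (5 + (t₄ + t₅))), h1.seqs_cons (h2.seqs_cons (h3.seqs_cons (h4.seqs_cons (Exec.seqs_one h5)))),
    by omega, ?_, ?_, ?_, ?_, fun a ha => ?_⟩
  · simp [hR₄, hR₃]
  · simp [hR₄, hR₃]
  · simp [hR₄, hR₃]
  · rw [Function.update_self, hR₄, Function.update_self, Function.update_of_ne (by decide),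
      Function.update_of_ne (by decide), h44₃, h50₃, max_assoc]
    simp [hR₃]
  · simp only [List.mem_cons, List.not_mem_nil, or_false, not_or] at ha
    obtain ⟨h40a, h41a, h44a, h50a, h51a, h53a, h59a⟩ := ha
    simp [hR₄, hR₃, hR₂, hR₁, h40a, h41a, h44a, h50a, h51a, h53a, h59a]

/-- **The normal branch.** `NFIN := numVars`, the padding if `k ≥ 2` and the last variable is
absent, and `LY := OUT - Bv - 1`, within `26` steps. [folklore] -/
theorem thenNormal_exec (k : ℕ) {G R : ℕ → ℕ} {Bv n nv : ℕ} {wl : List ℕ} (hBv : 100 ≤ Bv)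
    (h24 : R 24 = n) (h30 : R 30 = Bv) (h40 : R 40 = Bv + 3 + wl.length) (h42 : R 42 = nv)
    (hw : Bv + 3 + wl.length + 3 < 2 ^ w) (hnw : n + n < 2 ^ w) (h41 : R 41 + 1 < 2 ^ w) (qs : List (List ℕ)) :
    ∃ (R' : ℕ → ℕ) (t : ℕ), Exec w O (thenNormal k) ⟨merge R (outMem G (Bv + 3) wl), qs⟩
        ⟨merge R' (outMem G (Bv + 3) (wl ++ if 2 ≤ k ∧ nv < n then [2, 2 * n - 1, 2 * n - 2] else [])), qs⟩ t ∧
      t ≤ 26 ∧ R' 53 = (if 2 ≤ k ∧ nv < n then n else nv) ∧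
      R' 41 = R 41 + (if 2 ≤ k ∧ nv < n then 1 else 0) ∧
      R' 44 = (if 2 ≤ k ∧ nv < n then max (R 44) (max (2 * n - 1) 2) else R 44) ∧
      R' 40 = Bv + 3 + (wl ++ if 2 ≤ k ∧ nv < n then [2, 2 * n - 1, 2 * n - 2] else []).length ∧
      R' 52 = 2 + (wl ++ if 2 ≤ k ∧ nv < n then [2, 2 * n - 1, 2 * n - 2] else []).length ∧
      ∀ a, a ∉ [40, 41, 44, 50, 51, 52, 53, 59] → R' a = R a := by
  -- 1. NFIN := NMAX; T := (NMAX < N0)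
  set R₁ : ℕ → ℕ := Function.update (Function.update R 53 nv) 50 (if nv < n then 1 else 0) with hR₁
  have h1 : Exec w O (block [(.div, r 53, r 42, im 1), (.lt, r 50, r 42, r 24)]) ⟨merge R (outMem G (Bv + 3) wl), qs⟩
      ⟨merge R₁ (outMem G (Bv + 3) wl), qs⟩ 2 := by
    refine Exec.block' _ qs ?_
    simp (disch := first | decide | omega) only [execOps_cons, execOps_nil, execOp, Operand.read,
      Operand.write, merge_apply_of_lt, update_merge_of_lt, Function.update_of_ne, h42, h24, BinOp.eval_div_one,
      BinOp.eval_lt, hR₁]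
  -- 2. the padding
  have h2 : ∃ (R₂ : ℕ → ℕ) (t : ℕ), Exec w O (if 2 ≤ k then ifz (r 50) skip padBlock else skip)
      ⟨merge R₁ (outMem G (Bv + 3) wl), qs⟩
      ⟨merge R₂ (outMem G (Bv + 3) (wl ++ if 2 ≤ k ∧ nv < n then [2, 2 * n - 1, 2 * n - 2] else [])), qs⟩ t ∧
      t ≤ 22 ∧ R₂ 53 = (if 2 ≤ k ∧ nv < n then n else nv) ∧
      R₂ 41 = R 41 + (if 2 ≤ k ∧ nv < n then 1 else 0) ∧
      R₂ 44 = (if 2 ≤ k ∧ nv < n then max (R 44) (max (2 * n - 1) 2) else R 44) ∧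
      R₂ 40 = Bv + 3 + (wl ++ if 2 ≤ k ∧ nv < n then [2, 2 * n - 1, 2 * n - 2] else []).length ∧
      ∀ a, a ∉ [40, 41, 44, 50, 51, 53, 59] → R₂ a = R₁ a := by
    by_cases hk : 2 ≤ k
    · by_cases hlt : nv < n
      · have hpad : (2 ≤ k ∧ nv < n) := ⟨hk, hlt⟩
        obtain ⟨R₂, t, hex, ht, h40', h41', h53', h44', hR₂⟩ := padBlock_exec (w := w) (O := O) (G := G) (R := R₁)
          (e₀ := Bv + 3) (n := n) (wl := wl) (by omega) (by omega) (by simp [hR₁, h24]) (by simp [hR₁, h40]) hw hnw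
          (by simp [hR₁]; exact h41) qs
        refine ⟨R₂, t + 2, ?_, by omega, ?_, ?_, ?_, ?_, fun a ha => hR₂ a ha⟩
        · rw [if_pos hk, if_pos hpad]
          exact Exec.ifz_ne (by rw [read_r (by decide)]; simp [hR₁, hlt]) hex
        · rw [if_pos hpad, h53']
        · rw [if_pos hpad, h41']; simp [hR₁]
        · rw [if_pos hpad, h44']; simp [hR₁]
        · rw [if_pos hpad, h40']; simp; omega
      · have hpad : ¬ (2 ≤ k ∧ nv < n) := fun h => hlt h.2
        refine ⟨R₁, 0 + 1, ?_, by omega, ?_, ?_, ?_, ?_, fun a _ => rfl⟩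
        · rw [if_pos hk, if_neg hpad, List.append_nil]
          exact Exec.ifz_zero (by rw [read_r (by decide)]; simp [hR₁, hlt]) (Exec.skip _)
        · rw [if_neg hpad]; simp [hR₁]
        · rw [if_neg hpad]; simp [hR₁]
        · rw [if_neg hpad]; simp [hR₁]
        · rw [if_neg hpad, List.append_nil]; simp [hR₁, h40]
    · have hpad : ¬ (2 ≤ k ∧ nv < n) := fun h => hk h.1
      refine ⟨R₁, 0, ?_, by omega, ?_, ?_, ?_, ?_, fun a _ => rfl⟩
      · rw [if_neg hk, if_neg hpad, List.append_nil]; exact Exec.skip _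
      · rw [if_neg hpad]; simp [hR₁]
      · rw [if_neg hpad]; simp [hR₁]
      · rw [if_neg hpad]; simp [hR₁]
      · rw [if_neg hpad, List.append_nil]; simp [hR₁, h40]
  obtain ⟨R₂, t₂, hex₂, ht₂, h53₂, h41₂, h44₂, h40₂, hR₂⟩ := h2
  set wl' := wl ++ (if 2 ≤ k ∧ nv < n then [2, 2 * n - 1, 2 * n - 2] else []) with hwl'
  have hlen : wl'.length ≤ wl.length + 3 := by rw [hwl']; split_ifs <;> simp
  -- 3. LY := OUT - Bv - 1
  have h30₂ : R₂ 30 = Bv := by rw [hR₂ 30 (by decide)]; simp [hR₁, h30]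
  have hS1 : BinOp.eval w .sub (Bv + 3 + wl'.length) Bv = 3 + wl'.length := by
    rw [BinOp.eval_sub_of_le (by omega) (by omega)]; omega
  have hS2 : BinOp.eval w .sub (3 + wl'.length) 1 = 2 + wl'.length := by
    rw [BinOp.eval_sub_of_le (by omega) (by omega)]; omega
  set R₃ : ℕ → ℕ := Function.update R₂ 52 (2 + wl'.length) with hR₃
  have h3 : Exec w O (block [(.sub, r 52, r 40, r 30), (.sub, r 52, r 52, im 1)]) ⟨merge R₂ (outMem G (Bv + 3) wl'), qs⟩
      ⟨merge R₃ (outMem G (Bv + 3) wl'), qs⟩ 2 := by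
    refine Exec.block' _ qs ?_
    simp (disch := first | decide | omega) only [execOps_cons, execOps_nil, execOp, Operand.read,
      Operand.write, merge_apply_of_lt, update_merge_of_lt, Function.update_self, h40₂,
      h30₂, hS1, hS2, hR₃, Function.update_idem]
  refine ⟨R₃, 2 + (t₂ + 2), h1.seqs_cons (hex₂.seqs_cons (Exec.seqs_one h3)), by omega, ?_, ?_, ?_, ?_, ?_,
    fun a ha => ?_⟩
  · simp [hR₃, h53₂]
  · simp [hR₃, h41₂]
  · simp [hR₃, h44₂]
  · simp [hR₃, h40₂]
  · simp [hR₃]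
  · simp only [List.mem_cons, List.not_mem_nil, or_false, not_or] at ha
    obtain ⟨h40a, h41a, h44a, h50a, h51a, h52a, h53a, h59a⟩ := ha
    rw [hR₃, Function.update_of_ne h52a, hR₂ a (by simp [*])]
    simp [hR₁, h53a, h50a]

/-- **The header.** Cells `Bv + 1, Bv + 2, Bv` receive `NFIN, M, LY`, making the presented list
`LY :: NFIN :: M :: words` one output region from `Bv`, and `WMAX` absorbs `NFIN, M, LY, 1`, within
`22` steps. [folklore] -/
theorem header_exec {H R : ℕ → ℕ} {Bv n₁ m₁ ly : ℕ} {ws : List ℕ} (hBv : 100 ≤ Bv) (h30 : R 30 = Bv)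
    (h53 : R 53 = n₁) (h41 : R 41 = m₁) (h52 : R 52 = ly) (hw : Bv + 2 < 2 ^ w) (qs : List (List ℕ)) :
    ∃ (R' : ℕ → ℕ) (t : ℕ), Exec w O header ⟨merge R (outMem H (Bv + 3) ws), qs⟩
        ⟨merge R' (outMem H Bv (ly :: n₁ :: m₁ :: ws)), qs⟩ t ∧
      t ≤ 22 ∧ R' 44 = max (max (max (max (R 44) n₁) m₁) ly) 1 ∧
      ∀ a, a ∉ [44, 50, 51, 59] → R' a = R a := by
  have hA1 : BinOp.eval w .add Bv 1 = Bv + 1 := BinOp.eval_add_of_lt (by omega)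
  have hA2 : BinOp.eval w .add Bv 2 = Bv + 2 := BinOp.eval_add_of_lt hw
  set R₁ : ℕ → ℕ := Function.update (Function.update R 50 (Bv + 2)) 51 1 with hR₁
  have h1 : Exec w O (block [(.add, r 50, r 30, im 1), (.div, pt 50, r 53, im 1), (.add, r 50, r 30, im 2),
      (.div, pt 50, r 41, im 1), (.div, pt 30, r 52, im 1), (.band, r 51, im 1, im 1)])
      ⟨merge R (outMem H (Bv + 3) ws), qs⟩ ⟨merge R₁ (outMem H Bv (ly :: n₁ :: m₁ :: ws)), qs⟩ 6 := by
    refine Exec.block' _ qs ?_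
    simp (disch := first | decide | omega) only [execOps_cons, execOps_nil, execOp, Operand.read,
      Operand.write, merge_apply_of_lt, update_merge_of_lt, update_merge_of_le, Function.update_of_ne,
      Function.update_self, h30, h53, h41, h52, hA1, hA2, BinOp.eval_div_one, BinOp.eval_band, Nat.and_self,
      outMem_update_below, outMem_header, hR₁, Function.update_idem]
  obtain ⟨t₂, ht₂, h2⟩ := maxInto_exec (w := w) (O := O) (R := R₁) (H := outMem H Bv (ly :: n₁ :: m₁ :: ws))
    (dst := 44) (src := 53) (s := 59) (by decide) (by decide) (by decide) (by decide) (by decide) qs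
  set R₂ : ℕ → ℕ := Function.update (Function.update R₁ 59 (if R₁ 44 < R₁ 53 then 1 else 0)) 44
    (max (R₁ 44) (R₁ 53)) with hR₂
  obtain ⟨t₃, ht₃, h3⟩ := maxInto_exec (w := w) (O := O) (R := R₂) (H := outMem H Bv (ly :: n₁ :: m₁ :: ws))
    (dst := 44) (src := 41) (s := 59) (by decide) (by decide) (by decide) (by decide) (by decide) qs
  set R₃ : ℕ → ℕ := Function.update (Function.update R₂ 59 (if R₂ 44 < R₂ 41 then 1 else 0)) 44
    (max (R₂ 44) (R₂ 41)) with hR₃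
  obtain ⟨t₄, ht₄, h4⟩ := maxInto_exec (w := w) (O := O) (R := R₃) (H := outMem H Bv (ly :: n₁ :: m₁ :: ws))
    (dst := 44) (src := 52) (s := 59) (by decide) (by decide) (by decide) (by decide) (by decide) qs
  set R₄ : ℕ → ℕ := Function.update (Function.update R₃ 59 (if R₃ 44 < R₃ 52 then 1 else 0)) 44
    (max (R₃ 44) (R₃ 52)) with hR₄
  obtain ⟨t₅, ht₅, h5⟩ := maxInto_exec (w := w) (O := O) (R := R₄) (H := outMem H Bv (ly :: n₁ :: m₁ :: ws))
    (dst := 44) (src := 51) (s := 59) (by decide) (by decide) (by decide) (by decide) (by decide) qs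
  refine ⟨_, 6 + (t₂ + (t₃ + (t₄ + t₅))), h1.seqs_cons (h2.seqs_cons (h3.seqs_cons (h4.seqs_cons (Exec.seqs_one h5)))),
    by omega, ?_, fun a ha => ?_⟩
  · rw [Function.update_self]
    simp [hR₄, hR₃, hR₂, hR₁, h53, h41, h52]
  · simp only [List.mem_cons, List.not_mem_nil, or_false, not_or] at ha
    obtain ⟨h44a, h50a, h51a, h59a⟩ := ha
    simp [hR₄, hR₃, hR₂, hR₁, h44a, h50a, h51a, h59a]

/-- The halving loop: from `r56 = v / 2^i`, `r54 = i`. [folklore] -/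
theorem sizeLoop_exec {H : ℕ → ℕ} (qs : List (List ℕ)) (hw3 : w < 2 ^ w) :
    ∀ (d : ℕ) (R : ℕ → ℕ) (v i : ℕ), R 56 = v / 2 ^ i → R 54 = i → Nat.size v = i + d → v < 2 ^ w →
      ∃ (R' : ℕ → ℕ) (t : ℕ), Exec w O (whilenz (r 56) (block [(.shr, r 56, r 56, im 1), (.add, r 54, r 54, im 1)]))
          ⟨merge R H, qs⟩ ⟨merge R' H, qs⟩ t ∧
        t ≤ 4 * d + 1 ∧ R' 54 = Nat.size v ∧ R' 56 = 0 ∧ ∀ a, a ∉ [54, 56] → R' a = R a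
  | 0, R, v, i, h56, h54, hsz, hv => by
    have hz : v / 2 ^ i = 0 := Nat.div_eq_of_lt (by rw [Nat.add_zero] at hsz; rw [← hsz]; exact Nat.lt_size_self v)
    refine ⟨R, 1, Exec.while_zero (by rw [read_r (by decide), h56, hz]), by omega, by rw [h54]; omega,
      by rw [h56, hz], fun a _ => rfl⟩
  | d + 1, R, v, i, h56, h54, hsz, hv => by
    have hsv : Nat.size v ≤ w := Nat.size_le.2 hv
    have hne : v / 2 ^ i ≠ 0 := by
      intro h0
      have : v < 2 ^ i := by
        rcases Nat.eq_zero_or_pos (2 ^ i) with h | h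
        · exact absurd h (Nat.two_pow_pos i).ne'
        · exact (Nat.div_eq_zero_iff_lt h).1 h0
      have := Nat.size_le.2 this
      omega
    have hA : BinOp.eval w .add i 1 = i + 1 := BinOp.eval_add_of_lt (by omega)
    set R₁ : ℕ → ℕ := Function.update (Function.update R 56 (v / 2 ^ (i + 1))) 54 (i + 1) with hR₁
    have h1 : Exec w O (block [(.shr, r 56, r 56, im 1), (.add, r 54, r 54, im 1)]) ⟨merge R H, qs⟩
        ⟨merge R₁ H, qs⟩ 2 := by
      refine Exec.block' _ qs ?_
      simp (disch := first | decide | omega) only [execOps_cons, execOps_nil, execOp, Operand.read,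
        Operand.write, merge_apply_of_lt, update_merge_of_lt, Function.update_of_ne, h56, h54, hA,
        BinOp.eval_shr, hR₁]
      rw [Nat.shiftRight_eq_div_pow, pow_one, Nat.div_div_eq_div_mul, ← pow_succ]
    obtain ⟨R', t, h2, ht, h54', h56', hR'⟩ := sizeLoop_exec qs hw3 d R₁ v (i + 1) (by simp [hR₁]) (by simp [hR₁])
      (by omega) hv
    refine ⟨R', 2 + t + 2, Exec.while_ne (by rw [read_r (by decide), h56]; exact hne) h1 h2, by omega, h54', h56',
      fun a ha => ?_⟩
    simp only [List.mem_cons, List.not_mem_nil, or_false, not_or] at ha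
    rw [hR' a (by simp [ha])]; simp [hR₁, ha.1, ha.2]

/-- **The width**: `WY := Nat.size WMAX`, within `4 · size + 3` steps. [folklore] -/
theorem widthP_exec {H R : ℕ → ℕ} {v : ℕ} (h44 : R 44 = v) (hv : v < 2 ^ w) (hw3 : w < 2 ^ w)
    (qs : List (List ℕ)) :
    ∃ (R' : ℕ → ℕ) (t : ℕ), Exec w O widthP ⟨merge R H, qs⟩ ⟨merge R' H, qs⟩ t ∧
      t ≤ 4 * Nat.size v + 3 ∧ R' 54 = Nat.size v ∧ R' 56 = 0 ∧ ∀ a, a ∉ [54, 56] → R' a = R a := by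
  set R₁ : ℕ → ℕ := Function.update (Function.update R 56 v) 54 0 with hR₁
  have h1 : Exec w O (block [(.div, r 56, r 44, im 1), (.band, r 54, im 0, im 0)]) ⟨merge R H, qs⟩ ⟨merge R₁ H, qs⟩ 2 := by
    refine Exec.block' _ qs ?_
    simp (disch := first | decide | omega) only [execOps_cons, execOps_nil, execOp, Operand.read,
      Operand.write, merge_apply_of_lt, update_merge_of_lt, h44, BinOp.eval_div_one,
      BinOp.eval_band, Nat.and_self, hR₁]
  obtain ⟨R', t, h2, ht, h54', h56', hR'⟩ := sizeLoop_exec (w := w) (O := O) (H := H) qs hw3 (Nat.size v) R₁ v 0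
    (by simp [hR₁]) (by simp [hR₁]) (by omega) hv
  refine ⟨R', 2 + t, h1.seqs_cons (Exec.seqs_one h2), by omega, h54', h56', fun a ha => ?_⟩
  simp only [List.mem_cons, List.not_mem_nil, or_false, not_or] at ha
  rw [hR' a (by simp [ha])]; simp [hR₁, ha.1, ha.2]

/-- **The word size**: `WS := k' (NFIN + WY)`, `rP := 2 ^ WS`. [folklore] -/
theorem wsP_exec (k' : ℕ) {H R : ℕ → ℕ} {n₁ wy : ℕ} (h53 : R 53 = n₁) (h54 : R 54 = wy)
    (hws : k' * (n₁ + wy) < w) (hw3 : w < 2 ^ w) (hnw : n₁ + wy < 2 ^ w) (qs : List (List ℕ)) :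
    Exec w O (wsP k') ⟨merge R H, qs⟩
      ⟨merge (Function.update (Function.update R 55 (k' * (n₁ + wy))) 33 (2 ^ (k' * (n₁ + wy)))) H, qs⟩ 3 := by
  have hA : BinOp.eval w .add n₁ wy = n₁ + wy := BinOp.eval_add_of_lt hnw
  have hM : BinOp.eval w .mul (n₁ + wy) k' = k' * (n₁ + wy) := by
    rw [BinOp.eval_mul_of_lt (by rw [Nat.mul_comm]; omega), Nat.mul_comm]
  have hS : BinOp.eval w .shl 1 (k' * (n₁ + wy)) = 2 ^ (k' * (n₁ + wy)) := by
    rw [BinOp.eval_shl_of_lt (by rw [one_mul]; exact Nat.pow_lt_pow_right (by norm_num) hws), one_mul]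
  refine Exec.block' _ qs ?_
  simp (disch := first | decide | omega) only [execOps_cons, execOps_nil, execOp, Operand.read,
    Operand.write, merge_apply_of_lt, update_merge_of_lt, Function.update_self, h53, h54,
    hA, hM, hS, Function.update_idem]

/-- The data memory after `i` rounds of the reduce-and-stamp pass over the presented list `zs`
(cells from `Bv`, stamps from `Sv`, generation `Gn`, modulus `P`). [folklore] -/
def stampData (D : ℕ → ℕ) (Bv Sv Gn P : ℕ) (zs : List ℕ) (i : ℕ) : ℕ → ℕ := fun a =>
  if Bv ≤ a ∧ a < Bv + i then zs.getD (a - Bv) 0 % P else if Sv ≤ a ∧ a < Sv + i then Gn else D a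

/-- No rounds: the data is unchanged. [folklore] -/
@[simp] theorem stampData_zero (D : ℕ → ℕ) (Bv Sv Gn P : ℕ) (zs : List ℕ) : stampData D Bv Sv Gn P zs 0 = D := by
  funext a; unfold stampData; rw [if_neg (by omega), if_neg (by omega)]

/-- The cell about to be processed is still the original one. [folklore] -/
theorem stampData_apply_cell {D : ℕ → ℕ} {Bv Sv Gn P : ℕ} {zs : List ℕ} {i : ℕ} (h : Bv + i < Sv) :
    stampData D Bv Sv Gn P zs i (Bv + i) = D (Bv + i) := by
  unfold stampData; rw [if_neg (by omega), if_neg (by omega)]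

/-- One more round. [folklore] -/
theorem stampData_succ {D : ℕ → ℕ} {Bv Sv Gn P : ℕ} {zs : List ℕ} {i : ℕ} (h : Bv + zs.length ≤ Sv)
    (hi : i < zs.length) (hD : D (Bv + i) = zs.getD i 0) :
    Function.update (Function.update (stampData D Bv Sv Gn P zs i) (Bv + i) (D (Bv + i) % P)) (Sv + i) Gn =
      stampData D Bv Sv Gn P zs (i + 1) := by
  funext a
  by_cases h1 : a = Sv + i
  · subst h1; rw [Function.update_self]; unfold stampData; rw [if_neg (by omega), if_pos (by omega)]
  · rw [Function.update_of_ne h1]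
    by_cases h2 : a = Bv + i
    · subst h2; rw [Function.update_self, hD]; unfold stampData; rw [if_pos (by omega), Nat.add_sub_cancel_left]
    · rw [Function.update_of_ne h2]; unfold stampData
      by_cases h3 : Bv ≤ a ∧ a < Bv + i
      · rw [if_pos h3, if_pos (by omega)]
      · rw [if_neg h3]
        by_cases h4 : Bv ≤ a ∧ a < Bv + (i + 1)
        · exact absurd h4 (by omega)
        · rw [if_neg h4]
          by_cases h5 : Sv ≤ a ∧ a < Sv + i
          · rw [if_pos h5, if_pos (by omega)]
          · rw [if_neg h5, if_neg (by omega)]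

/-- Outside the two stamped ranges the data is unchanged. [folklore] -/
theorem stampData_apply_of_not {D : ℕ → ℕ} {Bv Sv Gn P : ℕ} {zs : List ℕ} {i a : ℕ}
    (h1 : ¬ (Bv ≤ a ∧ a < Bv + i)) (h2 : ¬ (Sv ≤ a ∧ a < Sv + i)) : stampData D Bv Sv Gn P zs i a = D a := by
  unfold stampData; rw [if_neg h1, if_neg h2]

/-- The loop of the reduce-and-stamp pass. [folklore] -/
theorem stampLoop_exec {D : ℕ → ℕ} {Bv Sv Gn P : ℕ} {zs : List ℕ} (hBv : 100 ≤ Bv) (hdisj : Bv + zs.length ≤ Sv)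
    (hSv : Sv + zs.length < 2 ^ w) (hD : ∀ i, i < zs.length → D (Bv + i) = zs.getD i 0) (qs : List (List ℕ)) :
    ∀ (d : ℕ) (R : ℕ → ℕ) (i : ℕ), R 57 = Bv + i → R 58 = Sv + i → R 50 = d → i + d = zs.length → R 33 = P →
      R 32 = Gn →
      ∃ (R' : ℕ → ℕ) (t : ℕ), Exec w O (whilenz (r 50) (block [(.mod, pt 57, pt 57, r 33), (.div, pt 58, r 32, im 1),
          (.add, r 57, r 57, im 1), (.add, r 58, r 58, im 1), (.sub, r 50, r 50, im 1)]))
          ⟨merge R (stampData D Bv Sv Gn P zs i), qs⟩ ⟨merge R' (stampData D Bv Sv Gn P zs zs.length), qs⟩ t ∧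
        t ≤ 7 * d + 1 ∧ R' 50 = 0 ∧ R' 57 = Bv + zs.length ∧ R' 58 = Sv + zs.length ∧
        ∀ a, a ∉ [50, 57, 58] → R' a = R a
  | 0, R, i, h57, h58, h50, hid, _, _ => by
    rw [Nat.add_zero] at hid; subst hid
    exact ⟨R, 1, Exec.while_zero (by rw [read_r (by decide), h50]), by omega, h50, h57, h58, fun a _ => rfl⟩
  | d + 1, R, i, h57, h58, h50, hid, h33, h32 => by
    have hi : i < zs.length := by omega
    have hA1 : BinOp.eval w .add (Bv + i) 1 = Bv + i + 1 := BinOp.eval_add_of_lt (by omega)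
    have hA2 : BinOp.eval w .add (Sv + i) 1 = Sv + i + 1 := BinOp.eval_add_of_lt (by omega)
    have hS : BinOp.eval w .sub (d + 1) 1 = d := by rw [BinOp.eval_sub_of_le (by omega) (by omega)]; rfl
    have hcell : stampData D Bv Sv Gn P zs i (Bv + i) = D (Bv + i) := stampData_apply_cell (by omega)
    set R₁ : ℕ → ℕ := Function.update (Function.update (Function.update R 57 (Bv + i + 1)) 58 (Sv + i + 1)) 50 d
      with hR₁
    have h1 : Exec w O (block [(.mod, pt 57, pt 57, r 33), (.div, pt 58, r 32, im 1), (.add, r 57, r 57, im 1),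
        (.add, r 58, r 58, im 1), (.sub, r 50, r 50, im 1)]) ⟨merge R (stampData D Bv Sv Gn P zs i), qs⟩
        ⟨merge R₁ (stampData D Bv Sv Gn P zs (i + 1)), qs⟩ 5 := by
      refine Exec.block' _ qs ?_
      rw [← stampData_succ hdisj hi (hD i hi)]
      simp (disch := first | decide | omega) only [execOps_cons, execOps_nil, execOp, Operand.read,
        Operand.write, merge_apply_of_lt, merge_apply_of_le, update_merge_of_lt, update_merge_of_le,
        Function.update_of_ne, h57, h58, h50, h33, h32, hcell, hA1, hA2, hS, BinOp.eval_mod,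
        BinOp.eval_div_one, hR₁]
    obtain ⟨R', t, h2, ht, h50', h57', h58', hR'⟩ := stampLoop_exec (Gn := Gn) (P := P) hBv hdisj hSv hD qs d R₁ (i + 1)
      (by simp [hR₁, Nat.add_assoc]) (by simp [hR₁, Nat.add_assoc]) (by simp [hR₁]) (by omega)
      (by simp [hR₁, h33]) (by simp [hR₁, h32])
    refine ⟨R', 5 + t + 2, Exec.while_ne (by rw [read_r (by decide), h50]; exact Nat.succ_ne_zero d) h1 h2, by omega,
      h50', h57', h58', fun a ha => ?_⟩
    simp only [List.mem_cons, List.not_mem_nil, or_false, not_or] at ha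
    rw [hR' a (by simp [ha])]; simp [hR₁, ha.1, ha.2.1, ha.2.2]

/-- **The reduce-and-stamp pass** over the `LY + 1` cells of the presented list: afterwards cell
`Bv + a` holds `zs[a] % 2^ws` and stamp `Sv + a` holds the generation, for `a ≤ LY`, within
`7 (LY + 1) + 4` steps. [folklore] -/
theorem stampPass_exec {D R : ℕ → ℕ} {Bv Sv Gn P : ℕ} {zs : List ℕ} (hBv : 100 ≤ Bv) (hdisj : Bv + zs.length ≤ Sv)
    (hSv : Sv + zs.length < 2 ^ w) (hD : ∀ i, i < zs.length → D (Bv + i) = zs.getD i 0) (h30 : R 30 = Bv)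
    (h31 : R 31 = Sv) (h32 : R 32 = Gn) (h33 : R 33 = P) (h52 : R 52 + 1 = zs.length) (qs : List (List ℕ)) :
    ∃ (R' : ℕ → ℕ) (t : ℕ), Exec w O stampPass ⟨merge R D, qs⟩ ⟨merge R' (stampData D Bv Sv Gn P zs zs.length), qs⟩ t ∧
      t ≤ 7 * zs.length + 4 ∧ R' 50 = 0 ∧ R' 57 = Bv + zs.length ∧ R' 58 = Sv + zs.length ∧
      ∀ a, a ∉ [50, 57, 58] → R' a = R a := by
  have hA : BinOp.eval w .add (R 52) 1 = zs.length := by rw [BinOp.eval_add_of_lt (by omega), h52]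
  set R₁ : ℕ → ℕ := Function.update (Function.update (Function.update R 57 Bv) 58 Sv) 50 zs.length with hR₁
  have h1 : Exec w O (block [(.div, r 57, r 30, im 1), (.div, r 58, r 31, im 1), (.add, r 50, r 52, im 1)])
      ⟨merge R D, qs⟩ ⟨merge R₁ (stampData D Bv Sv Gn P zs 0), qs⟩ 3 := by
    refine Exec.block' _ qs ?_
    simp (disch := first | decide | omega) only [execOps_cons, execOps_nil, execOp, Operand.read,
      Operand.write, merge_apply_of_lt, update_merge_of_lt, Function.update_of_ne, h30, h31, hA, BinOp.eval_div_one,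
      stampData_zero, hR₁]
  obtain ⟨R', t, h2, ht, h50', h57', h58', hR'⟩ := stampLoop_exec (w := w) (O := O) (Gn := Gn) (P := P) hBv hdisj hSv hD qs
    zs.length R₁ 0
    (by simp [hR₁]) (by simp [hR₁]) (by simp [hR₁]) (by omega) (by simp [hR₁, h33]) (by simp [hR₁, h32])
  refine ⟨R', 3 + t, h1.seqs_cons (Exec.seqs_one h2), by omega, h50', h57', h58', fun a ha => ?_⟩
  simp only [List.mem_cons, List.not_mem_nil, or_false, not_or] at ha
  rw [hR' a (by simp [ha])]; simp [hR₁, ha.1, ha.2.1, ha.2.2]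

/-! ### Facts about the presented formula -/

/-- A leaf with an empty clause presents the empty formula. [folklore] -/
theorem pres_of_mem {k n : ℕ} {cs : CNF ℕ} (h : [] ∈ cs) : pres k n cs = [] := by
  unfold pres; rw [if_pos h]

/-- A leaf without an empty clause presents itself, padded if need be. [folklore] -/
theorem pres_of_not_mem {k n : ℕ} {cs : CNF ℕ} (h : [] ∉ cs) :
    pres k n cs = cs ++ (if 2 ≤ k ∧ CNF.numVars cs < n then [padClause n] else []) := by
  unfold pres; rw [if_neg h]; split_ifs <;> simp

/-- `clauseWords` is additive. [folklore] -/
theorem clauseWords_append (cs ds : CNF ℕ) :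
    KSatTranscoder.clauseWords (cs ++ ds) = KSatTranscoder.clauseWords cs ++ KSatTranscoder.clauseWords ds := by
  simp [KSatTranscoder.clauseWords]

/-- `numVars` as a list maximum. [folklore] -/
theorem numVars_eq_lmax (cs : CNF ℕ) : CNF.numVars cs = lmax (cs.flatten.map fun l => l.1 + 1) := rfl

/-- Padding restores the number of variables. [folklore] -/
theorem numVars_append_padClause {n : ℕ} {cs : CNF ℕ} (h : CNF.numVars cs < n) :
    CNF.numVars (cs ++ [padClause n]) = n := by
  rw [numVars_eq_lmax, List.flatten_append, List.map_append, lmax_append, ← numVars_eq_lmax]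
  simp [padClause, lmax]
  omega

/-- The largest padding word. [folklore] -/
theorem lmax_padWords (n : ℕ) : lmax [2, 2 * n - 1, 2 * n - 2] = max (2 * n - 1) 2 := by
  simp [lmax]; omega

/-- The argument of `Nat.size` in `inputWidth` of the presented word list. [folklore] -/
theorem widthArg_eq (n₁ m₁ : ℕ) (ws : List ℕ) (W0 : ℕ) (hW0 : W0 = lmax ws) :
    max (max (max (max W0 n₁) m₁) (n₁ :: m₁ :: ws).length) 1 =
      max (max (n₁ :: m₁ :: ws).length 1) (lmax (n₁ :: m₁ :: ws)) := by
  subst hW0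
  simp only [lmax, List.foldr_cons]
  simp only [max_assoc, max_comm, max_left_comm]

/-- The first phase of the tail: the branch on the empty-clause count. [folklore] -/
theorem branch_exec (k : ℕ) {H R : ℕ → ℕ} {Bv n : ℕ} (cs : CNF ℕ) (hBv : 100 ≤ Bv) (h24 : R 24 = n)
    (h30 : R 30 = Bv) (h40 : R 40 = Bv + 3 + (KSatTranscoder.clauseWords cs).length) (h41 : R 41 = cs.length)
    (h42 : R 42 = CNF.numVars cs) (h43 : R 43 = emptyCount cs) (h44 : R 44 = lmax (KSatTranscoder.clauseWords cs))
    (hw : Bv + (KSatTranscoder.clauseWords cs).length + 6 < 2 ^ w) (hnn : n + n < 2 ^ w) (qs : List (List ℕ)) :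
    ∃ (R' : ℕ → ℕ) (t : ℕ), Exec w O (ifz (r 43) (thenNormal k) elseEmpty)
        ⟨merge R (outMem H (Bv + 3) (KSatTranscoder.clauseWords cs)), qs⟩
        ⟨merge R' (outMem (if [] ∈ cs then outMem H (Bv + 3) (KSatTranscoder.clauseWords cs) else H) (Bv + 3)
          (KSatTranscoder.clauseWords (pres k n cs))), qs⟩ t ∧
      t ≤ 28 ∧ R' 53 = CNF.numVars (pres k n cs) ∧ R' 41 = CNF.numClauses (pres k n cs) ∧
      R' 52 = (encodeCNFWords (pres k n cs)).length ∧ R' 44 = lmax (KSatTranscoder.clauseWords (pres k n cs)) ∧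
      ∀ a, a ∉ [40, 41, 44, 50, 51, 52, 53, 59] → R' a = R a := by
  by_cases hE : [] ∈ cs
  · -- the empty-clause branch
    have hne : emptyCount cs ≠ 0 := emptyCount_ne_zero_iff.2 hE
    rw [if_pos hE, pres_of_mem hE]
    set R₁ : ℕ → ℕ := Function.update (Function.update (Function.update (Function.update R 52 2) 53 0) 41 0) 44 0
      with hR₁
    have h1 : Exec w O elseEmpty ⟨merge R (outMem H (Bv + 3) (KSatTranscoder.clauseWords cs)), qs⟩
        ⟨merge R₁ (outMem H (Bv + 3) (KSatTranscoder.clauseWords cs)), qs⟩ 4 := by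
      refine Exec.block' _ qs ?_
      simp (disch := first | decide | omega) only [execOps_cons, execOps_nil, execOp, Operand.read,
        Operand.write, update_merge_of_lt, BinOp.eval_band, Nat.and_self, hR₁]
    refine ⟨R₁, 4 + 2, ?_, by omega, by simp [hR₁, CNF.numVars], by simp [hR₁, CNF.numClauses],
      by simp [hR₁, encodeCNFWords], by simp [hR₁, KSatTranscoder.clauseWords, lmax],
      fun a ha => ?_⟩
    · have : KSatTranscoder.clauseWords ([] : CNF ℕ) = [] := rfl
      rw [this, outMem_nil]
      exact Exec.ifz_ne (by rw [read_r (by decide), h43]; exact hne) h1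
    · simp only [List.mem_cons, List.not_mem_nil, or_false, not_or] at ha
      simp [hR₁, ha.2.1, ha.2.2.1, ha.2.2.2.2.2.1, ha.2.2.2.2.2.2.1]
  · -- the normal branch
    have hz : emptyCount cs = 0 := by by_contra h; exact hE (emptyCount_ne_zero_iff.1 h)
    rw [if_neg hE, pres_of_not_mem hE]
    obtain ⟨R₁, t, hex, ht, h53', h41', h44', h40', h52', hR₁⟩ := thenNormal_exec (w := w) (O := O) k (G := H) (R := R)
      (Bv := Bv) (n := n) (nv := CNF.numVars cs) (wl := KSatTranscoder.clauseWords cs) hBv h24 h30 h40 h42 (by omega) hnn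
      (by rw [h41]; have := length_le_length_clauseWords cs; omega) qs
    have hcw : KSatTranscoder.clauseWords (cs ++ if 2 ≤ k ∧ CNF.numVars cs < n then [padClause n] else []) =
        KSatTranscoder.clauseWords cs ++ (if 2 ≤ k ∧ CNF.numVars cs < n then [2, 2 * n - 1, 2 * n - 2] else []) := by
      rw [clauseWords_append]
      split_ifs with h
      · rw [clauseWords_padClause n (by omega)]
      · rfl
    refine ⟨R₁, t + 1, ?_, by omega, ?_, ?_, ?_, ?_, hR₁⟩
    · rw [hcw]; exact Exec.ifz_zero (by rw [read_r (by decide), h43, hz]) hex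
    · rw [h53']
      split_ifs with h
      · rw [numVars_append_padClause h.2]
      · rw [List.append_nil]
    · rw [h41', h41, CNF.numClauses, List.length_append]
      split_ifs <;> simp
    · rw [h52', KSatTranscoder.encodeCNFWords_eq, hcw]; simp; omega
    · rw [h44', h44, hcw]
      split_ifs with h
      · rw [lmax_append, lmax_padWords]
      · rw [List.append_nil]

/-- Entries of the presented word list are bounded like the leaf's data. [folklore] -/
theorem pres_words_lt {k n V : ℕ} {cs : CNF ℕ} (hn : n + n < V) (hV : 2 < V)
    (hlen : (KSatTranscoder.clauseWords cs).length + 6 < V) (hnv : CNF.numVars cs ≤ n)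
    (hcw : ∀ a ∈ KSatTranscoder.clauseWords cs, a < V) :
    (∀ a ∈ encodeCNFWords (pres k n cs), a < V) ∧ (encodeCNFWords (pres k n cs)).length + 1 < V := by
  by_cases hE : [] ∈ cs
  · rw [pres_of_mem hE]; simp [encodeCNFWords, CNF.numVars, CNF.numClauses]; omega
  · rw [pres_of_not_mem hE, KSatTranscoder.encodeCNFWords_eq, clauseWords_append]
    have hcl := length_le_length_clauseWords cs
    constructor
    · intro a ha
      simp only [List.mem_cons, List.mem_append] at ha
      rcases ha with rfl | rfl | ha | ha
      · split_ifs with h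
        · rw [numVars_append_padClause h.2]; omega
        · rw [List.append_nil]; omega
      · rw [CNF.numClauses, List.length_append]
        split_ifs with h
        · simp only [List.length_singleton]; omega
        · simp only [List.length_nil]; omega
      · exact hcw a ha
      · split_ifs at ha with h
        · rw [clauseWords_padClause n (by omega)] at ha
          simp only [List.mem_cons, List.not_mem_nil, or_false] at ha
          rcases ha with rfl | rfl | rfl <;> omega
        · simp [KSatTranscoder.clauseWords] at ha
    · simp only [List.length_cons, List.length_append]
      split_ifs with h
      · rw [clauseWords_padClause n (by omega)]
        simp only [List.length_cons, List.length_nil]; omega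
      · rw [show KSatTranscoder.clauseWords ([] : CNF ℕ) = [] from rfl, List.length_nil]; omega

/-- **The tail of the leaf body.** From the parser's output (`clauseWords` of the leaf from
`Bv + 3`, counters in `41 … 44`) the tail leaves the presented list `|y| :: y`,
`y = encodeCNFWords (pres k n cs)`, reduced modulo `2^ws` in the cells from `Bv` and stamped with the
generation from `Sv`, with `ws = k' (numVars + inputWidth y)` and `2^ws` in register `33`, within
`7 |y| + 4 w + 70` steps. [folklore] -/
theorem leafTail_exec (k k' : ℕ) {H R : ℕ → ℕ} {Bv Sv Gn n : ℕ} (cs : CNF ℕ) (hBv : 100 ≤ Bv) (h24 : R 24 = n)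
    (h30 : R 30 = Bv) (h31 : R 31 = Sv) (h32 : R 32 = Gn) (h40 : R 40 = Bv + 3 + (KSatTranscoder.clauseWords cs).length)
    (h41 : R 41 = cs.length) (h42 : R 42 = CNF.numVars cs) (h43 : R 43 = emptyCount cs)
    (h44 : R 44 = lmax (KSatTranscoder.clauseWords cs)) (hdisj : Bv + (KSatTranscoder.clauseWords cs).length + 9 ≤ Sv)
    (hSv : Sv + (KSatTranscoder.clauseWords cs).length + 9 < 2 ^ w) (hnn : n + n < 2 ^ w) (hnw : n + w < 2 ^ w)
    (hnv : CNF.numVars cs ≤ n) (hcw : ∀ a ∈ KSatTranscoder.clauseWords cs, a < 2 ^ w)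
    (hws : k' * (CNF.numVars (pres k n cs) + inputWidth (encodeCNFWords (pres k n cs))) < w) (qs : List (List ℕ)) :
    ∃ (R' : ℕ → ℕ) (t : ℕ), Exec w O (leafTail k k') ⟨merge R (outMem H (Bv + 3) (KSatTranscoder.clauseWords cs)), qs⟩
        ⟨merge R' (stampData
          (outMem (if [] ∈ cs then outMem H (Bv + 3) (KSatTranscoder.clauseWords cs) else H) Bv
            ((encodeCNFWords (pres k n cs)).length :: encodeCNFWords (pres k n cs)))
          Bv Sv Gn (2 ^ (k' * (CNF.numVars (pres k n cs) + inputWidth (encodeCNFWords (pres k n cs)))))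
          ((encodeCNFWords (pres k n cs)).length :: encodeCNFWords (pres k n cs))
          ((encodeCNFWords (pres k n cs)).length + 1)), qs⟩ t ∧
      t ≤ 7 * (encodeCNFWords (pres k n cs)).length + 4 * w + 70 ∧
      R' 33 = 2 ^ (k' * (CNF.numVars (pres k n cs) + inputWidth (encodeCNFWords (pres k n cs)))) ∧
      R' 53 = CNF.numVars (pres k n cs) ∧ R' 52 = (encodeCNFWords (pres k n cs)).length ∧
      ∀ a, a ∉ [33, 40, 41, 44, 50, 51, 52, 53, 54, 55, 56, 57, 58, 59] → R' a = R a := by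
  set prs := pres k n cs with hprs
  set y := encodeCNFWords prs with hy
  set zs := y.length :: y with hzs
  set n₁ := CNF.numVars prs with hn₁
  set m₁ := CNF.numClauses prs with hm₁
  set cwp := KSatTranscoder.clauseWords prs with hcwp
  set H₁ : ℕ → ℕ := if [] ∈ cs then outMem H (Bv + 3) (KSatTranscoder.clauseWords cs) else H with hH₁
  have hw3 : w < 2 ^ w := Nat.lt_two_pow_self
  have hyeq : y = n₁ :: m₁ :: cwp := by rw [hy, KSatTranscoder.encodeCNFWords_eq]
  obtain ⟨hyV, hylen⟩ := pres_words_lt (k := k) (cs := cs) hnn (by omega) (by omega) hnv hcw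
  rw [← hprs, ← hy] at hyV hylen
  have hn₁n : n₁ ≤ n := by
    rw [hn₁, hprs]
    by_cases hE : [] ∈ cs
    · rw [pres_of_mem hE]; exact Nat.zero_le _
    · rw [pres_of_not_mem hE]
      split_ifs with h
      · rw [numVars_append_padClause h.2]
      · rwa [List.append_nil]
  have hylen' : y.length ≤ (KSatTranscoder.clauseWords cs).length + 5 := by
    rw [hy, hprs]
    by_cases hE : [] ∈ cs
    · rw [pres_of_mem hE]; simp [encodeCNFWords]
    · rw [pres_of_not_mem hE, KSatTranscoder.encodeCNFWords_eq, clauseWords_append]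
      simp only [List.length_cons, List.length_append]
      split_ifs with h
      · rw [clauseWords_padClause n (by omega)]; simp
      · simp [KSatTranscoder.clauseWords]
  -- 1. the branch
  obtain ⟨R₁, t₁, h1, ht₁, h53₁, h41₁, h52₁, h44₁, hR₁⟩ := branch_exec (w := w) (O := O) k (H := H) (R := R) cs hBv h24
    h30 h40 h41 h42 h43 h44 (by omega) hnn qs
  rw [← hprs, ← hH₁] at h1
  rw [← hprs] at h53₁ h41₁ h52₁ h44₁
  rw [← hn₁] at h53₁; rw [← hm₁] at h41₁; rw [← hy] at h52₁; rw [← hcwp] at h44₁ h1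
  have h30₁ : R₁ 30 = Bv := by rw [hR₁ 30 (by decide), h30]
  -- 2. the header
  obtain ⟨R₂, t₂, h2, ht₂, h44₂, hR₂⟩ := header_exec (w := w) (O := O) (H := H₁) (R := R₁) (ws := cwp) hBv h30₁ h53₁
    h41₁ h52₁ (by omega) qs
  rw [← hyeq] at h2
  have hWA : R₂ 44 = max (max y.length 1) (lmax y) := by
    rw [h44₂, h44₁, hyeq]; exact widthArg_eq n₁ m₁ cwp _ rfl
  have hWAlt : max (max y.length 1) (lmax y) < 2 ^ w :=
    lt_of_le_of_lt (widthArg_le (V := 2 ^ w - 1) (by omega) (by omega) fun a ha => by have := hyV a ha; omega)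
      (by omega)
  -- 3. the width
  obtain ⟨R₃, t₃, h3, ht₃, h54₃, h56₃, hR₃⟩ := widthP_exec (w := w) (O := O) (H := outMem H₁ Bv (y.length :: y))
    (R := R₂) hWA hWAlt hw3 qs
  rw [← inputWidth_eq_size] at h54₃
  have hszw : inputWidth y ≤ w := by rw [inputWidth_eq_size]; exact Nat.size_le.2 hWAlt
  have hsz4 : 4 * Nat.size (max (max y.length 1) (lmax y)) ≤ 4 * w := by
    rw [← inputWidth_eq_size]; exact Nat.mul_le_mul_left 4 hszw
  -- 4. the word size
  have h53₃ : R₃ 53 = n₁ := by rw [hR₃ 53 (by decide), hR₂ 53 (by decide), h53₁]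
  have h4 := wsP_exec (w := w) (O := O) k' (H := outMem H₁ Bv (y.length :: y)) (R := R₃) h53₃ h54₃ hws hw3 (by omega) qs
  set R₄ : ℕ → ℕ := Function.update (Function.update R₃ 55 (k' * (n₁ + inputWidth y))) 33
    (2 ^ (k' * (n₁ + inputWidth y))) with hR₄
  -- 5. the stamps
  have h30₄ : R₄ 30 = Bv := by simp [hR₄, hR₃ 30 (by decide), hR₂ 30 (by decide), h30₁]
  have h31₄ : R₄ 31 = Sv := by simp [hR₄, hR₃ 31 (by decide), hR₂ 31 (by decide), hR₁ 31 (by decide), h31]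
  have h32₄ : R₄ 32 = Gn := by simp [hR₄, hR₃ 32 (by decide), hR₂ 32 (by decide), hR₁ 32 (by decide), h32]
  have h52₄ : R₄ 52 + 1 = zs.length := by
    simp [hR₄, hR₃ 52 (by decide), hR₂ 52 (by decide), h52₁, hzs]
  obtain ⟨R₅, t₅, h5, ht₅, -, -, -, hR₅⟩ := stampPass_exec (w := w) (O := O) (D := outMem H₁ Bv zs) (R := R₄)
    (Bv := Bv) (Sv := Sv) (Gn := Gn) (P := 2 ^ (k' * (n₁ + inputWidth y))) (zs := zs) hBv
    (by rw [hzs, List.length_cons]; omega) (by rw [hzs, List.length_cons]; omega)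
    (fun i hi => by rw [outMem_add _ _ _ hi, List.getD_eq_getElem _ _ hi]) h30₄ h31₄ h32₄ (by simp [hR₄]) h52₄ qs
  refine ⟨R₅, t₁ + (t₂ + (t₃ + (3 + t₅))), h1.seqs_cons (h2.seqs_cons (h3.seqs_cons (h4.seqs_cons (Exec.seqs_one h5)))),
    ?_, ?_, ?_, ?_, fun a ha => ?_⟩
  · rw [hzs, List.length_cons] at ht₅; omega
  · rw [hR₅ 33 (by decide)]; simp [hR₄]
  · rw [hR₅ 53 (by decide)]; simp [hR₄, h53₃]
  · rw [hR₅ 52 (by decide)]; simp [hR₄, hR₃ 52 (by decide), hR₂ 52 (by decide), h52₁]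
  · simp only [List.mem_cons, List.not_mem_nil, or_false, not_or] at ha
    obtain ⟨h33a, h40a, h41a, h44a, h50a, h51a, h52a, h53a, h54a, h55a, h56a, h57a, h58a, h59a⟩ := ha
    rw [hR₅ a (by simp [*]), hR₄, Function.update_of_ne h33a, Function.update_of_ne h55a, hR₃ a (by simp [*]),
      hR₂ a (by simp [*]), hR₁ a (by simp [*])]

/-! ### Constants of the routines -/

/-- The constants of the parser are the registers (`< 100`), `κ` and the codes. [folklore] -/
theorem cle_formulaP {V : ℕ} (C : PCodes) (κ : ℕ) (hV : 100 ≤ V) (hC : C.sup ≤ V) (hκ : κ ≤ V) :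
    CLE V (formulaP C κ) := by
  simp only [PCodes.sup, max_le_iff] at hC
  simp only [formulaP, skipBits, clauseBody, clauseCore, litBody, litCore, bitBody, maxInto, advance, tst, CLE,
    cle_seqs_cons, cle_seqs_nil, cle_block_cons, cle_block_nil, Operand.const_dir, Operand.const_ind,
    Operand.const_imm, and_true, true_and]
  omega

/-- The constants of the leaf body are the registers, `κ`, `k'`, the codes and small numbers. [folklore] -/
theorem cle_leafBody {V : ℕ} (C : PCodes) (κ k k' : ℕ) (hV : 100 ≤ V) (hC : C.sup ≤ V) (hκ : κ ≤ V) (hk' : k' ≤ V) :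
    CLE V (leafBody C κ k k') := by
  refine ⟨?_, cle_formulaP C κ hV hC hκ, ?_, trivial⟩
  · simp only [leafInit, cle_block_cons, cle_block_nil, Operand.const_dir, Operand.const_imm, and_true]; omega
  · unfold leafTail thenNormal
    split_ifs <;>
    · simp only [elseEmpty, header, widthP, wsP, stampPass, padBlock, maxInto, CLE, cle_seqs_cons, cle_seqs_nil,
        cle_block_cons, cle_block_nil, Operand.const_dir, Operand.const_ind, Operand.const_imm, and_true, true_and]
      omega

/-- The constants of `post`. [folklore] -/
theorem cle_post {V : ℕ} (hV : 100 ≤ V) : CLE V post := by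
  simp only [post, erdAt, lay, CLE, cle_seqs_cons, cle_seqs_nil, cle_block_cons, cle_block_nil,
    Operand.const_dir, Operand.const_ind, Operand.const_imm, and_true]
  omega

/-- The constants of `fin`. [folklore] -/
theorem cle_fin {V : ℕ} (hV : 100 ≤ V) : CLE V fin := by
  simp only [fin, cle_block_cons, cle_block_nil, Operand.const_dir, Operand.const_imm, and_true]
  omega

/-! ### The leaf body -/

/-- **The start of the leaf body**: the generation is bumped, the output pointer and the counters
are reset. [folklore] -/
theorem leafInit_exec {H R : ℕ → ℕ} {Bv G : ℕ} (h30 : R 30 = Bv) (h32 : R 32 = G) (hG : G + 1 < 2 ^ w)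
    (hBv : Bv + 3 < 2 ^ w) (qs : List (List ℕ)) :
    Exec w O leafInit ⟨merge R H, qs⟩
      ⟨merge (Function.update (Function.update (Function.update (Function.update (Function.update
        (Function.update R 32 (G + 1)) 40 (Bv + 3)) 41 0) 42 0) 43 0) 44 0) H, qs⟩ 6 := by
  have hA1 : BinOp.eval w .add G 1 = G + 1 := BinOp.eval_add_of_lt hG
  have hA2 : BinOp.eval w .add Bv 3 = Bv + 3 := BinOp.eval_add_of_lt hBv
  refine Exec.block' _ qs ?_
  simp (disch := first | decide | omega) only [execOps_cons, execOps_nil, execOp, Operand.read,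
    Operand.write, merge_apply_of_lt, update_merge_of_lt, Function.update_of_ne, h30, h32, hA1, hA2, BinOp.eval_band,
    Nat.and_self]

/-- **The leaf body.** From a store whose stack stream holds `ψ.encode ++ [blank]` at the current
height, the leaf body consumes it and presents `y = encodeCNFWords (pres k n ψ.clauses)` — reduced
modulo `2^ws`, stamped with the bumped generation — to the emulator, within
`formulaTime ψ + 7 |y| + 4 w + 76` steps. [folklore] -/
theorem leafBody_exec (k k' : ℕ) {kk : ℕ} (ψ : KCNF kk) {H R : ℕ → ℕ} {BOT j Bv Sv G n : ℕ} (hBOT : 100 ≤ BOT)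
    (hBv : 100 ≤ Bv) (h20 : R 20 = BOT + κ * j) (h24 : R 24 = n) (h30 : R 30 = Bv) (h31 : R 31 = Sv) (h32 : R 32 = G)
    (hst : StreamAt H BOT κ j ((ψ.encode ++ [Γ'.blank]).map C.cd)) (hsep : C.Sep (ψ.encode ++ [Γ'.blank]))
    (hje : BOT + κ * j < Bv) (hdisj : Bv + (KSatTranscoder.clauseWords ψ.clauses).length + 9 ≤ Sv)
    (hSv : Sv + (KSatTranscoder.clauseWords ψ.clauses).length + 9 < 2 ^ w) (hG : G + 1 < 2 ^ w)
    (hnn : n + n < 2 ^ w) (hnw : n + w < 2 ^ w) (hnv : CNF.numVars ψ.clauses ≤ n)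
    (hpw : ∀ c ∈ ψ.clauses, ∀ l ∈ c, 2 ^ (l.1.bits.length + 1) < 2 ^ w)
    (hws : k' * (CNF.numVars (pres k n ψ.clauses) + inputWidth (encodeCNFWords (pres k n ψ.clauses))) < w)
    (qs : List (List ℕ)) :
    ∃ (R' : ℕ → ℕ) (t : ℕ), Exec w O (leafBody C κ k k') ⟨merge R H, qs⟩
        ⟨merge R' (stampData
          (outMem (if [] ∈ ψ.clauses then outMem H (Bv + 3) (KSatTranscoder.clauseWords ψ.clauses) else H) Bv
            ((encodeCNFWords (pres k n ψ.clauses)).length :: encodeCNFWords (pres k n ψ.clauses)))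
          Bv Sv (G + 1) (2 ^ (k' * (CNF.numVars (pres k n ψ.clauses) + inputWidth (encodeCNFWords (pres k n ψ.clauses)))))
          ((encodeCNFWords (pres k n ψ.clauses)).length :: encodeCNFWords (pres k n ψ.clauses))
          ((encodeCNFWords (pres k n ψ.clauses)).length + 1)), qs⟩ t ∧
      t ≤ formulaTime ψ + 7 * (encodeCNFWords (pres k n ψ.clauses)).length + 4 * w + 76 ∧
      R' 20 = BOT + κ * (j - (ψ.encode.length + 1)) ∧ R' 32 = G + 1 ∧
      R' 33 = 2 ^ (k' * (CNF.numVars (pres k n ψ.clauses) + inputWidth (encodeCNFWords (pres k n ψ.clauses)))) ∧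
      R' 43 = emptyCount ψ.clauses ∧ R' 53 = CNF.numVars (pres k n ψ.clauses) ∧
      R' 52 = (encodeCNFWords (pres k n ψ.clauses)).length ∧
      ∀ a, a ∉ [20, 23, 32, 33, 40, 41, 42, 43, 44, 45, 46, 47, 48, 49, 50, 51, 52, 53, 54, 55, 56, 57, 58, 59, 62, 63] →
        R' a = R a := by
  -- the size facts of the clause words
  have hlw : ∀ c ∈ ψ.clauses, ∀ l ∈ c, 2 * l.1 + 1 < 2 ^ w := fun c hc l hl => by
    have h1 : l.1 + 1 ≤ CNF.numVars ψ.clauses := by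
      rw [numVars_eq_lmax]
      exact le_lmax_of_mem (List.mem_map.2 ⟨l, List.mem_flatten.2 ⟨c, hc, hl⟩, rfl⟩)
    omega
  have hcwlt : ∀ a ∈ KSatTranscoder.clauseWords ψ.clauses, a < 2 ^ w := by
    intro a ha
    simp only [KSatTranscoder.clauseWords, List.mem_flatMap, List.mem_cons, List.mem_map] at ha
    obtain ⟨c, hc, ha⟩ := ha
    rcases ha with rfl | ⟨l, hl, rfl⟩
    · have h1 : (c.length :: c.map litWord).length ≤ (KSatTranscoder.clauseWords ψ.clauses).length := by
        have := ((List.singleton_sublist.2 hc).flatMap (fun c : List (ℕ × Bool) => c.length :: c.map litWord)).length_le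
        simpa [KSatTranscoder.clauseWords] using this
      simp only [List.length_cons, List.length_map] at h1
      omega
    · have := hlw c hc l hl; unfold litWord; cases l.2 <;> simp <;> omega
  -- 1. the start
  have h1 := leafInit_exec (w := w) (O := O) (H := H) h30 h32 hG (by omega) qs
  set R₁ : ℕ → ℕ := Function.update (Function.update (Function.update (Function.update (Function.update
    (Function.update R 32 (G + 1)) 40 (Bv + 3)) 41 0) 42 0) 43 0) 44 0 with hR₁
  -- 2. the parser
  obtain ⟨R₂, t₂, h2, ht₂, h20₂, -, -, h40₂, h41₂, h43₂, h42₂, h44₂, hR₂⟩ := formulaP_exec (w := w) (O := O) (C := C)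
    (κ := κ) (G := H) (R := R₁) (e₀ := Bv + 3) (ys := []) hBOT (by omega) ψ (by simp [hR₁, h20]) hst hsep (by simp [hR₁])
    (by omega) (by simp; omega) hpw hlw (by simp [hR₁]; have := length_le_length_clauseWords ψ.clauses; omega)
    (by simp [hR₁]; have := length_le_length_clauseWords ψ.clauses; omega) qs
  rw [outMem_nil] at h2
  simp only [List.nil_append, List.length_nil, Nat.add_zero] at h2 h40₂
  simp only [hR₁, Function.update_self, Function.update_of_ne (show (41 : ℕ) ≠ 42 by decide),
    Function.update_of_ne (show (41 : ℕ) ≠ 43 by decide), Function.update_of_ne (show (41 : ℕ) ≠ 44 by decide),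
    Function.update_of_ne (show (42 : ℕ) ≠ 43 by decide), Function.update_of_ne (show (42 : ℕ) ≠ 44 by decide),
    Function.update_of_ne (show (43 : ℕ) ≠ 44 by decide), zero_add, Nat.zero_max] at h41₂ h43₂ h42₂ h44₂
  -- 3. the tail
  obtain ⟨R₃, t₃, h3, ht₃, h33₃, h53₃, h52₃, hR₃⟩ := leafTail_exec (w := w) (O := O) k k' (H := H) (R := R₂)
    (Bv := Bv) (Sv := Sv) (Gn := G + 1) (n := n) ψ.clauses hBv (by rw [hR₂ 24 (by decide)]; simp [hR₁, h24])
    (by rw [hR₂ 30 (by decide)]; simp [hR₁, h30]) (by rw [hR₂ 31 (by decide)]; simp [hR₁, h31])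
    (by rw [hR₂ 32 (by decide)]; simp [hR₁]) h40₂ h41₂ h42₂ h43₂ h44₂ hdisj hSv hnn hnw hnv hcwlt hws qs
  refine ⟨R₃, 6 + (t₂ + t₃), h1.seqs_cons (h2.seqs_cons (Exec.seqs_one h3)), by omega, ?_, ?_, h33₃, ?_, h53₃, h52₃,
    fun a ha => ?_⟩
  · rw [hR₃ 20 (by decide), h20₂]
  · rw [hR₃ 32 (by decide), hR₂ 32 (by decide)]; simp [hR₁]
  · rw [hR₃ 43 (by decide), h43₂]
  · simp only [List.mem_cons, List.not_mem_nil, or_false, not_or] at ha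
    rw [hR₃ a (by simp [ha]), hR₂ a (by simp [ha])]
    simp [hR₁, ha]

/-! ### What the leaf body presents to the emulator -/

/-- The initial memory of the emulated program, cell by cell. [folklore] -/
theorem init_mem_getD (ws : ℕ) (y : List ℕ) (a : ℕ) : (init ws y).mem a = (y.length :: y).getD a 0 % 2 ^ ws := by
  rcases Nat.eq_zero_or_pos a with rfl | ha
  · rw [init_mem_zero]; rfl
  · obtain ⟨i, rfl⟩ := Nat.exists_eq_add_of_le' ha
    rw [List.getD_cons_succ]
    by_cases hi : i < y.length
    · rw [init_mem_succ ws y i hi, List.getD_eq_getElem _ _ hi]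
    · rw [init_mem_of_length_lt ws y (i + 1) (by omega), List.getD_eq_default _ _ (by omega), Nat.zero_mod]

/-- A fresh stamp. [folklore] -/
theorem stampData_stamp_lt {D : ℕ → ℕ} {Bv Sv Gn P : ℕ} {zs : List ℕ} {i a : ℕ} (ha : a < i) (h : Bv + i ≤ Sv) :
    stampData D Bv Sv Gn P zs i (Sv + a) = Gn := by
  unfold stampData; rw [if_neg (by omega), if_pos (by omega)]

/-- An old stamp. [folklore] -/
theorem stampData_stamp_ge {D : ℕ → ℕ} {Bv Sv Gn P : ℕ} {zs : List ℕ} {i a : ℕ} (ha : i ≤ a) (h : Bv + i ≤ Sv) :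
    stampData D Bv Sv Gn P zs i (Sv + a) = D (Sv + a) := by
  unfold stampData; rw [if_neg (by omega), if_neg (by omega)]

/-- A reduced cell. [folklore] -/
theorem stampData_cell_lt {D : ℕ → ℕ} {Bv Sv Gn P : ℕ} {zs : List ℕ} {i a : ℕ} (ha : a < i) :
    stampData D Bv Sv Gn P zs i (Bv + a) = zs.getD a 0 % P := by
  unfold stampData; rw [if_pos (by omega), Nat.add_sub_cancel_left]

/-- **The presented memory agrees with the initial memory of the emulated program** on the input
`y` (stamped cells hold the reduced words, every other stamp of the region is older). [folklore] -/
theorem present_agree {D R : ℕ → ℕ} {Bv Sv Gn ws Q : ℕ} {y : List ℕ} (hBv : 100 ≤ Bv) (hQ : y.length + 1 ≤ Q)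
    (hdisj : Bv + Q ≤ Sv) (hold : ∀ a, y.length + 1 ≤ a → a < Q → D (Sv + a) < Gn) :
    Agree ⟨Bv, Sv, Gn, ws, Q⟩ (merge R (stampData D Bv Sv Gn (2 ^ ws) (y.length :: y) (y.length + 1))) (init ws y).mem := by
  intro a ha
  change a < Q at ha
  simp only [edec]
  rw [merge_apply_of_le (show 100 ≤ Sv + a by omega), merge_apply_of_le (show 100 ≤ Bv + a by omega), init_mem_getD]
  by_cases hay : a < y.length + 1
  · rw [stampData_stamp_lt hay (by omega), if_pos rfl, stampData_cell_lt hay]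
  · rw [stampData_stamp_ge (by omega) (by omega), if_neg (hold a (by omega) ha).ne,
      List.getD_eq_default _ _ (by simp; omega), Nat.zero_mod]

/-- All stamps of the region are at most the generation. [folklore] -/
theorem present_stampLE {D R : ℕ → ℕ} {Bv Sv Gn ws Q : ℕ} {y : List ℕ} (hBv : 100 ≤ Bv) (hdisj : Bv + Q ≤ Sv)
    (hQ : y.length + 1 ≤ Q) (hold : ∀ a, y.length + 1 ≤ a → a < Q → D (Sv + a) < Gn) :
    StampLE ⟨Bv, Sv, Gn, ws, Q⟩ (merge R (stampData D Bv Sv Gn (2 ^ ws) (y.length :: y) (y.length + 1))) := by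
  intro a ha
  change a < Q at ha
  change merge R _ (Sv + a) ≤ Gn
  rw [merge_apply_of_le (show 100 ≤ Sv + a by omega)]
  by_cases hay : a < y.length + 1
  · rw [stampData_stamp_lt hay (by omega)]
  · rw [stampData_stamp_ge (by omega) (by omega)]; exact (hold a (by omega) ha).le

/-! ### After the emulated run, and the exit -/

/-- **After the run**: `B := ` emulated cell `1` (the answer bit of the emulated program), `ACC`
absorbs it unless the leaf had an empty clause, and the loop flag is recomputed, within `11` steps;
only the registers `22, 25, 26, 36` change. [folklore] -/
theorem post_exec {E : Env} {VT : ℕ} {m : ℕ → ℕ} (hOK : EnvOK lay E w) (hVT : VT + 1 = 2 ^ w)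
    (hinv : TInv lay E VT m) (hQ : 1 < E.Q) (h26 : 26 < E.Bv ∧ 26 < E.Sv) (hacc : m 25 ≤ 1) (hb : edec E m 1 ≤ 1)
    (qs : List (List ℕ)) :
    ∃ (m' : ℕ → ℕ) (t : ℕ), Exec w O post ⟨m, qs⟩ ⟨m', qs⟩ t ∧ t ≤ 11 ∧
      m' 25 = (if m 43 = 0 then (if 0 < m 25 + edec E m 1 then 1 else 0) else m 25) ∧
      m' 22 = (if m 21 < m 20 then 1 else 0) ∧ m' 26 = edec E m 1 ∧
      ∀ c, c ≠ 22 → c ≠ 25 → c ≠ 26 → c ≠ 36 → m' c = m c := by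
  -- 1. the emulated read
  obtain ⟨h26v, hfr⟩ := execOps_erdAt (L := lay) (E := E) (W := w) hOK hinv.env hVT hinv.memT
    (src := .imm 1) (T := 26) (operandStable_imm 1 _) (by decide) h26 (by simpa using hQ)
  set m₁ := execOps w m (erdAt lay (.imm 1) 26) with hm₁
  have h1 : Exec w O (block (erdAt lay (im 1) 26)) ⟨m, qs⟩ ⟨m₁, qs⟩ 6 := Exec.block' _ qs rfl
  simp only [Operand.read_imm] at h26v
  have hfr' : ∀ c, c ≠ 26 → c ≠ 36 → m₁ c = m c := fun c h1 h2 => hfr c h1 h2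
  -- 2. the accumulator
  have h2 : ∃ (m₂ : ℕ → ℕ) (t : ℕ), Exec w O (ifz (r 43) (block [(.add, r 25, r 25, r 26), (.lt, r 25, im 0, r 25)]) skip)
      ⟨m₁, qs⟩ ⟨m₂, qs⟩ t ∧ t ≤ 4 ∧
      m₂ 25 = (if m 43 = 0 then (if 0 < m 25 + edec E m 1 then 1 else 0) else m 25) ∧
      ∀ c, c ≠ 25 → m₂ c = m₁ c := by
    by_cases h43 : m 43 = 0
    · have hA : BinOp.eval w .add (m 25) (edec E m 1) = m 25 + edec E m 1 :=
        BinOp.eval_add_of_lt (by have : 4 ≤ 2 ^ w := by rw [← hVT]; have := hOK.fitB; omega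
                                 omega)
      refine ⟨_, 2 + 1, Exec.ifz_zero (by change m₁ 43 = 0; rw [hfr' 43 (by decide) (by decide), h43])
        (Exec.block' _ qs rfl), by omega, ?_, fun c hc => ?_⟩
      · rw [if_pos h43]
        simp only [execOps_cons, execOps_nil, execOp, Operand.read, Operand.write, Function.update_self,
          hfr' 25 (by decide) (by decide), h26v, hA, BinOp.eval_lt, Function.update_idem]
      · simp only [execOps_cons, execOps_nil, execOp, Operand.read, Operand.write, Function.update_idem,
          Function.update_of_ne hc]
    · refine ⟨m₁, 0 + 2, Exec.ifz_ne (by change m₁ 43 ≠ 0; rw [hfr' 43 (by decide) (by decide)]; exact h43) (Exec.skip _),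
        by omega, ?_, fun c _ => rfl⟩
      rw [if_neg h43, hfr' 25 (by decide) (by decide)]
  obtain ⟨m₂, t₂, hex₂, ht₂, h25₂, hfr₂⟩ := h2
  -- 3. the flag
  have h3 : Exec w O (block [(.lt, r 22, r 21, r 20)]) ⟨m₂, qs⟩ ⟨Function.update m₂ 22 (if m 21 < m 20 then 1 else 0), qs⟩ 1 :=
    Exec.block' _ qs (by
      simp only [execOps_cons, execOps_nil, execOp, Operand.read, Operand.write, BinOp.eval_lt,
        hfr₂ 21 (by decide), hfr₂ 20 (by decide), hfr' 21 (by decide) (by decide), hfr' 20 (by decide) (by decide)])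
  refine ⟨_, 6 + (t₂ + 1), h1.seqs_cons (hex₂.seqs_cons (Exec.seqs_one h3)), by omega, ?_, ?_, ?_, fun c h22 h25 h26 h36 => ?_⟩
  · rw [Function.update_of_ne (by decide), h25₂]
  · rw [Function.update_self]
  · rw [Function.update_of_ne (by decide), hfr₂ 26 (by decide), h26v]
  · rw [Function.update_of_ne h22, hfr₂ c h25, hfr' c h26 h36]

/-- **The exit**: output `[ACC]`. [folklore] -/
theorem fin_exec (m : ℕ → ℕ) (qs : List (List ℕ)) :
    Exec w O fin ⟨m, qs⟩ ⟨Function.update (Function.update m 1 (m 25)) 0 1, qs⟩ 2 ∧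
      readOut (Function.update (Function.update m 1 (m 25)) 0 1) = [m 25] := by
  refine ⟨Exec.block' _ qs ?_, ?_⟩
  · simp only [execOps_cons, execOps_nil, execOp, Operand.read, Operand.write, BinOp.eval_div_one, BinOp.eval_band,
      Nat.and_self]
  · simp [readOut, readSeg]

end exec

end Literature.Computability.FineGrained.SerfRed
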